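import Literature.NumberTheory.Rogawski1990.LocalTransfer                       -- ★ `IsDeltaTransferRel`, `stableOrbitalIntegralRel`, `TransferFactorData`
import Literature.NumberTheory.Automorphic.OrbitalIntegralChartRealisation        -- ★ `classOrbitalIntegral_mk_eq_zero_of_forall_conj_notMem_tsupport`
import HarnessLib

/-!
# F0 · P3c · line LH6 «StCharTS» — road (D) «DEEP-FL», brick D3-iii-orb «TRANSFER IDENTITY AT AN OFF-SUPPORT CLASS»: the pointwise transfer relation (4.3.1)
# `Φ^st_H(a, f^H) = Σ_c Δ(a, c) Φ(c, f)` holds at every `a` whose stable class misses `supp f^H` and whose matched classes miss `supp f` — both sides vanish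

Cell `pub/hodgecm-mathlib`, crux H413 = `stmt-HodgeConjecture-24833` (`--supports` lane, helper), route HCCMUnconditional; seat LH6-p04 (g2), road (D) owner;
status v3 `F0/P3b/LH6-p04/g2/ROAD-D.status.v3.txt`, brick D3-iii «OFF-STRATUM» — its ORBITAL-INTEGRAL half, GENERIC (any groups `A`, `B`, any matching relation
`R`, stable conjugacy `stA`, factor `T`, measure families; ★ `IsDeltaTransferRel` currency, LocalTransfer.lean :202).  THEOREMS ONLY, sorry-free, no definition ∕
instance ∕ notation ∕ named fact.  HONEST LABEL: HC_CM is proved only modulo the 7 printed citations (2 remaining: hLiu418 = stmt-HodgeConjecture-24832, h413 =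
stmt-HodgeConjecture-24833) until rung 0 closes; count-neutral.

THE MATHEMATICS ([Rogawski1990, §4.3 (4.3.1) p. 43]: the transfer identity is class by class; a class that meets neither support contributes `0 = 0`).  In road (D) the
pair is `(c_b·𝟙_{K_H b_H K_H}, 𝟙_{K_n b K_n})` and the OFF-STRATUM classes `a` (no unitary eigenframe, ★ HYP contrapositive) are shown support-disjoint by the VALUATION
tests (★ D1, ★ D3-iii-val, ★ HYP); this file turns «support-disjoint» into «the identity holds at `a`»:
* `stableOrbitalIntegralRel_eq_zero_of_forall` — if every class `c` with `stA a (out c)` has `Φ(c, f^H) = 0`, then `Φ^st(a, f^H) = 0`;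
* `finsum_delta_mul_classOrbitalIntegral_eq_zero_of_forall` — if every class `c` with `Δ(a, out c) ≠ 0` has `Φ(c, f) = 0`, the right side vanishes;
* `classOrbitalIntegral_eq_zero_of_forall_conj_notMem` — `Φ(c, f) = 0` when NO conjugate of `out c` lies in `tsupport f` (★, restated class-wise);
* **`isDeltaTransferRel_at_of_supports`** — the identity at `a` from the two support-disjointness hypotheses; **`isDeltaTransferRel_of_on_off`** — the full relation
  from «identity at every ON-stratum regular `a`» + «support-disjointness at every OFF-stratum regular `a`» (the shape D3 = D3-iv ∧ D3-iii takes).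

## References
* [Rogawski1990] J. D. Rogawski, *Automorphic Representations of Unitary Groups in Three Variables*, Ann. of Math. Stud. 123 (1990), §4.3 (4.3.1) p. 43; §12.7 p. 195.
-/

set_option autoImplicit false
-- the mandated namespace has the single-problem summit's repeated segment (`HodgeConjecture.HodgeConjecture`)
set_option linter.dupNamespace false

open Literature.NumberTheory.Rogawski1990 Literature.NumberTheory.Automorphic
open scoped BigOperators

namespace Summit.HodgeConjecture.HodgeConjecture.Cruxes.H413.F0P3cStCharTSTransferVanish

variable {A B : Type*} [Group A] [Group B]
  [∀ a : A, MeasurableSpace (A ⧸ Subgroup.centralizer ({a} : Set A))]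
  [∀ b : B, MeasurableSpace (B ⧸ Subgroup.centralizer ({b} : Set B))]

/-- `Φ^st(a, f^H) = 0` when every class in the stable class of `a` has vanishing orbital integral. [cite: Rogawski1990, §4.1 (4.1.1) p. 39] -/
theorem stableOrbitalIntegralRel_eq_zero_of_forall (stA : A → A → Prop) (mH : OrbitalMeasureFamily A) (fH : A → ℂ) (a : A)
    (h : ∀ c : ConjClasses A, stA a (Quotient.out c) → classOrbitalIntegral mH fH c = 0) :
    stableOrbitalIntegralRel stA mH fH a = 0 := by
  rw [stableOrbitalIntegralRel_def]
  exact finsum_mem_eq_zero_of_forall_eq_zero fun c hc => h c hc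

omit [∀ a : A, MeasurableSpace (A ⧸ Subgroup.centralizer ({a} : Set A))] in
/-- The endoscopic side `Σ_c Δ(a, out c) Φ(c, f)` vanishes when every class with `Δ(a, out c) ≠ 0` has `Φ(c, f) = 0`. [cite: Rogawski1990, §4.3 (4.3.1) p. 43] -/
theorem finsum_delta_mul_classOrbitalIntegral_eq_zero_of_forall {R : A → B → Prop} (T : TransferFactorData A B R)
    (mG : OrbitalMeasureFamily B) (f : B → ℂ) (a : A)
    (h : ∀ c : ConjClasses B, T.Δ a (Quotient.out c) ≠ 0 → classOrbitalIntegral mG f c = 0) :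
    ∑ᶠ c : ConjClasses B, T.Δ a (Quotient.out c) * classOrbitalIntegral mG f c = 0 := by
  refine finsum_eq_zero_of_forall_eq_zero fun c => ?_
  by_cases hΔ : T.Δ a (Quotient.out c) = 0
  · rw [hΔ, zero_mul]
  · rw [h c hΔ, mul_zero]

/-- `Φ(c, f) = 0` when no conjugate of `out c` lies in `tsupport f` (★ `classOrbitalIntegral_mk_eq_zero_of_forall_conj_notMem_tsupport`, class-wise).
[cite: Rogawski1990, §4.1 (4.1.1) p. 39] -/
theorem classOrbitalIntegral_eq_zero_of_forall_conj_notMem [TopologicalSpace B] (mG : OrbitalMeasureFamily B) (f : B → ℂ) (c : ConjClasses B)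
    (h : ∀ x : B, x * Quotient.out c * x⁻¹ ∉ tsupport f) : classOrbitalIntegral mG f c = 0 := by
  rw [← Quotient.out_eq c, ConjClasses.quotient_mk_eq_mk]
  exact classOrbitalIntegral_mk_eq_zero_of_forall_conj_notMem_tsupport mG h

/-- **THE TRANSFER IDENTITY AT A SUPPORT-DISJOINT CLASS.**  If no conjugate of a class stably conjugate to `a` meets `tsupport f^H`, and no conjugate of a class
`c` with `Δ(a, out c) ≠ 0` meets `tsupport f`, then `Φ^st(a, f^H) = Σ_c Δ(a, out c) Φ(c, f)` (both sides vanish).  This is the OFF-STRATUM half of road (D)'s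
D3 «MATCH» for the shell pair `(c_b·𝟙_{K_H b_H K_H}, 𝟙_{K_n b K_n})`. [cite: Rogawski1990, §4.3 (4.3.1) p. 43; §12.7 L. 12.7.3 (proof) p. 195] -/
theorem isDeltaTransferRel_at_of_supports [TopologicalSpace A] [TopologicalSpace B] {R : A → B → Prop} (stA : A → A → Prop)
    (T : TransferFactorData A B R) (mH : OrbitalMeasureFamily A) (mG : OrbitalMeasureFamily B) (fH : A → ℂ) (f : B → ℂ) (a : A)
    (hH : ∀ c : ConjClasses A, stA a (Quotient.out c) → ∀ x : A, x * Quotient.out c * x⁻¹ ∉ tsupport fH)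
    (hG : ∀ c : ConjClasses B, T.Δ a (Quotient.out c) ≠ 0 → ∀ x : B, x * Quotient.out c * x⁻¹ ∉ tsupport f) :
    stableOrbitalIntegralRel stA mH fH a = ∑ᶠ c : ConjClasses B, T.Δ a (Quotient.out c) * classOrbitalIntegral mG f c := by
  rw [stableOrbitalIntegralRel_eq_zero_of_forall stA mH fH a
      (fun c hc => classOrbitalIntegral_eq_zero_of_forall_conj_notMem mH fH c (hH c hc)),
    finsum_delta_mul_classOrbitalIntegral_eq_zero_of_forall T mG f a
      (fun c hc => classOrbitalIntegral_eq_zero_of_forall_conj_notMem mG f c (hG c hc))]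

/-- **D3 = (ON-stratum identity) ∧ (OFF-stratum support-disjointness).**  If the regular elements split as `regA = ON ∪ OFF` with the transfer identity proved at
every `ON` element and support-disjointness at every `OFF` element, then `f^H` is a `Δ`-transfer of `f` (★ `IsDeltaTransferRel`). [cite: Rogawski1990, §4.3 (4.3.1) p. 43] -/
theorem isDeltaTransferRel_of_on_off [TopologicalSpace A] [TopologicalSpace B] {R : A → B → Prop} (stA : A → A → Prop) (regA ON : A → Prop)
    (T : TransferFactorData A B R) (mH : OrbitalMeasureFamily A) (mG : OrbitalMeasureFamily B) (fH : A → ℂ) (f : B → ℂ)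
    (hon : ∀ a : A, regA a → ON a →
      stableOrbitalIntegralRel stA mH fH a = ∑ᶠ c : ConjClasses B, T.Δ a (Quotient.out c) * classOrbitalIntegral mG f c)
    (hoffH : ∀ a : A, regA a → ¬ ON a → ∀ c : ConjClasses A, stA a (Quotient.out c) → ∀ x : A, x * Quotient.out c * x⁻¹ ∉ tsupport fH)
    (hoffG : ∀ a : A, regA a → ¬ ON a → ∀ c : ConjClasses B, T.Δ a (Quotient.out c) ≠ 0 → ∀ x : B, x * Quotient.out c * x⁻¹ ∉ tsupport f) :
    IsDeltaTransferRel R stA regA T mH mG fH f := by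
  intro a ha
  by_cases hON : ON a
  · exact hon a ha hON
  · exact isDeltaTransferRel_at_of_supports stA T mH mG fH f a (hoffH a ha hON) (hoffG a ha hON)

end Summit.HodgeConjecture.HodgeConjecture.Cruxes.H413.F0P3cStCharTSTransferVanish
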